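import Mathlib.LinearAlgebra.Matrix.Permanent
import Mathlib.Data.ZMod.Basic
import Mathlib.Logic.Equiv.Fin.Basic
import Literature.Computability.Complexity.CodeFPModArith
import Summits.PneNP.PneNP.Theorems.PermanentDescentCollapseMakesPermanentEasyDefs
import HarnessLib

/-!
# Route PermanentDescent, crux `CollapseMakesPermanentEasy` (stmt-PneNP-16142), line `Sketch`
# (idea `errorless-islands`): the erasure random self-reduction of the permanent — objects (definitions only)

Objects of the BRIDGE of the line (`T ∈ P ∧ SoundIsland T ∧ DenseIsland T → PermBits ∈ P/poly`,
unconditional; with the landed uniformization `NP ⊆ P → PermBits ∈ P/poly → PermBits ∈ P` and the open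
density stub it composes to the crux). The argument (Lipton 1991's random self-reduction of the permanent,
erasure-only form, made non-uniform):

* An ISLAND is a language `T` of certified residues: words `encIsland p n l v` ("the `n × n` matrix over
  `𝔽_p` with row-major residue list `l` has permanent `v`"). It is SOUND when every certified value is the
  true permanent residue (`SoundIsland`), DENSE when for all large `n` and all primes `p ∈ (n³, 8n³]` at least
  a `4(n+1)/p` fraction of the matrices over `𝔽_p` are certified with their true value (`DenseIsland`).
* DECODING one residue (`lineTry`, `resFor`): on the line `M + c·D` (`c = 1, …, p-1`, `linePt`) through the
  target `M` with an advice direction `D`, ask the island for a certified value at every point (`certVal`,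
  scanning `v < p`); if `≥ n+1` points are certified, Lagrange-interpolate the degree-`≤ n` line polynomial
  `c ↦ perm(M + cD)` at `c = 0` from the first `n+1` of them (`lagrAt0`, residue arithmetic of
  `CodeFPModArith`); the advice lists several directions and the first success is taken (`resFor`).
* RECOMBINING (`crtVal`): the residues modulo the advice primes are combined with advice idempotents by the
  Chinese remainder formula; a side record (`SRec`) also carries a plain value table (`tabVal`) used for the
  finitely many small sides; `valR` is the value the record assigns to a 0/1 matrix word, `GoodRec` says it
  is the permanent at every word of side `n` (semantic goodness: existence of good records of polynomial
  length is the mathematical content of the bridge, their evaluation in polynomial time its machine content),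
  and `decideX` is the advice-taking decider of `PermBits` (parse `⟨s, bin i⟩` with `PermCert.wfB`, read the
  record of side `√|s|`, test bit `i` of its value).

Only objects are declared here (no facts): the statements about them are the registered stubs of the
skeleton `Cruxes/CollapseMakesPermanentEasy/Lines/Sketch.lean` and land as
`PermanentDescentCollapseMakesPermanentEasyIsland*.lean`. Sources: R. J. Lipton, *New directions in
testing*, DIMACS Ser. 2 (1991) 191–202, §3 (random self-reducibility of the permanent); D. Beaver,
J. Feigenbaum, STACS 1990, LNCS 415, 37–48 (hiding instances / lines through the target);
S. Arora, B. Barak, *Computational Complexity* (2009), §8.6.2 (Lipton's theorem, Thm. 8.33), Thm. 6.18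
(`P/poly` = `P` with advice), §A.4; J. von zur Gathen, J. Gerhard, *Modern Computer Algebra* (2013), §5.2,
§5.4 (Lagrange interpolation, Chinese remaindering).
-/

set_option linter.dupNamespace false -- `Summit.PneNP.PneNP.…`: summit = sub-problem name (D-0017 single-conjunct layout)

namespace Summit.PneNP.PneNP.Theorems.PermIsland

open _root_.Computability Literature.Computability.Complexity Literature.Computability.Complexity.Brick
  Literature.Computability.Complexity.ModArith
  Summit.PneNP.PneNP.Theorems.PermCert

/-! ### §1 Island queries, soundness, density -/

/-- **The island query word** `⟨bin p, ⟨bin n, ⟨[bin l₀, …], bin v⟩⟩⟩`: "the `n × n` matrix over `𝔽_p`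
whose row-major list of residues is `l` has permanent `v`" (the code
`pairE natE (pairE natE (pairE (rawE natE) natE))` of `(p, n, l, v)`). [folklore] -/
def encIsland (p n : ℕ) (l : List ℕ) (v : ℕ) : List Bool :=
  boolPair (encodeNat p) (boolPair (encodeNat n) (boolPair (encList (l.map encodeNat)) (encodeNat v)))

/-- The `n × n` matrix over `ZMod p` of a row-major residue list (entry `(a, b)` = letter `b + n·a`,
`0` past the end). [folklore] -/
def matOfRes (p n : ℕ) (l : List ℕ) : Matrix (Fin n) (Fin n) (ZMod p) :=
  Matrix.of fun a b : Fin n => ((l.getD ((b : ℕ) + n * (a : ℕ)) 0 : ℕ) : ZMod p)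

/-- The row-major residue list of a matrix over `ZMod p` (letter `b + n·a` = `(M a b).val`, through
Mathlib's `finProdFinEquiv (a, b) = b + n·a`). [folklore] -/
def resOfMat {p n : ℕ} (M : Matrix (Fin n) (Fin n) (ZMod p)) : List ℕ :=
  List.ofFn fun t : Fin (n * n) =>
    (M ((finProdFinEquiv (m := n) (n := n)).symm t).1 ((finProdFinEquiv (m := n) (n := n)).symm t).2).val

/-- The permanent residue of a residue list: `(perm (matOfRes p n l)).val`. [folklore] -/
def permRes (p n : ℕ) (l : List ℕ) : ℕ :=
  ((matOfRes p n l).permanent).val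

/-- **Sound islands**: every certified value of a well-formed query (prime modulus, `n²` reduced
residues) is the true permanent residue — the island never errs, it may only stay silent.
[cite: AroraBarakCC2009, §8.6.2] -/
def SoundIsland (T : Language Bool) : Prop :=
  ∀ (p n : ℕ) (l : List ℕ) (v : ℕ), p.Prime → l.length = n * n → (∀ x ∈ l, x < p) →
    encIsland p n l v ∈ T → v = permRes p n l

/-- **Dense islands**: for all large sides `n` and all primes `p ∈ (n³, 8n³]`, at least a `4(n+1)/p`
fraction of the `n × n` matrices over `𝔽_p` are certified with their true permanent (the erasure-decoding
threshold of the card `errorless-islands`; the prime range is the one Chinese remaindering uses).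
[cite: AroraBarakCC2009, §8.6.2] -/
def DenseIsland (T : Language Bool) : Prop :=
  ∃ n₀ : ℕ, ∀ n : ℕ, n₀ ≤ n → ∀ p : ℕ, p.Prime → n ^ 3 < p → p ≤ 8 * n ^ 3 →
    4 * (n + 1) * p ^ (n * n) ≤
      p * Nat.card {M : Matrix (Fin n) (Fin n) (ZMod p) // encIsland p n (resOfMat M) (M.permanent).val ∈ T}

/-! ### §2 Decoding one residue on a line through the target -/

/-- The residue list of a 0/1 matrix word (`true ↦ 1`, `false ↦ 0`). [folklore] -/
def resOfWord (s : List Bool) : List ℕ :=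
  s.map fun b => if b then 1 else 0

/-- **The point `M + c·D` of the line** through `M` (residue list `m`) in direction `D` (residue list
`d`), entrywise modulo `p`. [cite: AroraBarakCC2009, §8.6.2] -/
def linePt (p c : ℕ) (m d : List ℕ) : List ℕ :=
  List.zipWith (fun a b => addM p a (mulM p c b)) m d

/-- **The certified value at a query matrix** `q`: the first `v` of the candidate list `vs` (intended
`[0, …, p-1]`) whose query word the island predicate `χ` accepts, if any. [folklore] -/
def certVal (χ : List Bool → Bool) (p n : ℕ) (vs q : List ℕ) : Option ℕ :=
  vs.find? fun v => χ (encIsland p n q v)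

/-- **The certified points of the line**: the pairs `(c, v)` for the parameters `c` of `ls` (intended
`[1, …, p-1]`) at which the island certifies a value `v`, in the order of `ls`. [folklore] -/
def certPts (χ : List Bool → Bool) (p n : ℕ) (vs ls m d : List ℕ) : List (ℕ × ℕ) :=
  (ls.map fun c => ((certVal χ p n vs (linePt p c m d)).map (Prod.mk c)).toList).flatten

/-- **Lagrange weight at `0`** of the node `x` among the nodes `xs`:
`L_x(0) = ∏_{y ∈ xs, y ≠ x} y · (y - x)⁻¹ (mod p)` (the factor `y = x` replaced by `1`). [folklore] -/
def lagrWeight (p : ℕ) (xs : List ℕ) (x : ℕ) : ℕ :=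
  prodM p (xs.map fun y => if y = x then 1 % p else mulM p y (invM p (subM p y x)))

/-- **Lagrange interpolation at `0`** from the points `pts = [(x₀, y₀), …]` (distinct nodes modulo `p`):
`∑ᵢ yᵢ · L_{xᵢ}(0) (mod p)`. [folklore] -/
def lagrAt0 (p : ℕ) (pts : List (ℕ × ℕ)) : ℕ :=
  sumM p (pts.map fun q => mulM p q.2 (lagrWeight p (pts.map Prod.fst) q.1))

/-- **One decoding attempt**: if at least `n + 1` points of the line through `m` in direction `d` are
certified, the interpolated value at `0` of the first `n + 1` of them (the line polynomial
`c ↦ perm(M + cD)` has degree `≤ n`), else failure. [cite: AroraBarakCC2009, §8.6.2] -/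
def lineTry (χ : List Bool → Bool) (p n : ℕ) (vs ls m d : List ℕ) : Option ℕ :=
  if n + 1 ≤ (certPts χ p n vs ls m d).length then
    some (lagrAt0 p ((certPts χ p n vs ls m d).take (n + 1)))
  else none

/-- **Advice record for one prime**: `(p, (vs, (ls, (e, dirs))))` — the modulus, the candidate values
`[0, …, p-1]`, the line parameters `[1, …, p-1]`, the Chinese-remainder idempotent of `p`, and the advice
directions (residue lists). [folklore] -/
abbrev PRec : Type := ℕ × List ℕ × List ℕ × ℕ × List (List ℕ)

/-- **The decoded residue modulo the record's prime**: the first successful attempt over the advice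
directions (`0` if none succeeds). [cite: AroraBarakCC2009, §8.6.2] -/
def resFor (χ : List Bool → Bool) (n : ℕ) (P : PRec) (m : List ℕ) : ℕ :=
  (P.2.2.2.2.findSome? fun d => lineTry χ P.1 n P.2.1 P.2.2.1 m d).getD 0

/-! ### §3 Side records: Chinese remaindering, the small-side table, the decider -/

/-- **Advice record for one side `n`**: `(N, (tab, prs))` — the product modulus, a value table (pairs
`(word, value)`, used for small sides), and the prime records. [folklore] -/
abbrev SRec : Type := ℕ × List (List Bool × ℕ) × List PRec

/-- **Chinese remaindering**: `∑_P (residue for P) · (idempotent of P) (mod N)`. [cite: AroraBarakCC2009, §8.6.2] -/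
def crtVal (χ : List Bool → Bool) (n : ℕ) (r : SRec) (m : List ℕ) : ℕ :=
  sumM r.1 (r.2.2.map fun P => mulM r.1 (resFor χ n P m) P.2.2.2.1)

/-- Table lookup of a word (first binding). [folklore] -/
def tabVal (tab : List (List Bool × ℕ)) (s : List Bool) : Option ℕ :=
  (tab.find? fun q => decide (q.1 = s)).map Prod.snd

/-- **The value the record assigns to the 0/1 matrix word `s`**: the table's, else the remaindered
decoded residues. [folklore] -/
def valR (χ : List Bool → Bool) (n : ℕ) (r : SRec) (s : List Bool) : ℕ :=
  (tabVal r.2.1 s).getD (crtVal χ n r (resOfWord s))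

/-- **Good records** for side `n`: the assigned value is the permanent at every word of length `n²`. [folklore] -/
def GoodRec (χ : List Bool → Bool) (n : ℕ) (r : SRec) : Prop :=
  ∀ s : List Bool, s.length = n * n → valR χ n r s = permWord n s

/-- The empty record (default for list access). [folklore] -/
def defaultRec : SRec := (0, [], [])

/-- **The advice-taking decider of `PermBits`**: parse the query `x = ⟨s, bin i⟩` (`PermCert.wfB`), read
the record of side `√|s|` off the advice list `A`, and test bit `i` of its value at `s`.
[cite: AroraBarakCC2009, Thm. 6.18] -/
def decideX (χ : List Bool → Bool) (A : List SRec) (x : List Bool) : Bool :=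
  wfB x && (valR χ (Nat.sqrt (fstF x).length) (A.getD (Nat.sqrt (fstF x).length) defaultRec)
    (fstF x)).testBit (bitsToNat (sndF x))

/-! ### §4 Codes of the records (for the machine-level stubs) -/

/-- Code of a prime record: `pairE natE (pairE (rawE natE) (pairE (rawE natE) (pairE natE (rawE (rawE natE)))))`. [folklore] -/
def prE : PRec → List Bool :=
  CodeFP.pairE CodeFP.natE (CodeFP.pairE (CodeFP.rawE CodeFP.natE) (CodeFP.pairE (CodeFP.rawE CodeFP.natE)
    (CodeFP.pairE CodeFP.natE (CodeFP.rawE (CodeFP.rawE CodeFP.natE)))))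

/-- Code of a side record: `pairE natE (pairE (rawE (pairE strE natE)) (rawE prE))`. [folklore] -/
def srE : SRec → List Bool :=
  CodeFP.pairE CodeFP.natE (CodeFP.pairE (CodeFP.rawE (CodeFP.pairE CodeFP.strE CodeFP.natE)) (CodeFP.rawE prE))

end Summit.PneNP.PneNP.Theorems.PermIsland
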